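/-
Copyright: statement-level skeleton of a published paper (lit-balaban cell, Phase-2 proof seat p10, gen 5). No proof claims
beyond what the kernel checks below.
-/
import Mathlib
import Literature.MathematicalPhysics.QuantumFieldTheory.BalabanImbrieJaffe1984to88.BIJ85Eq7112FibreEnergy

/-!
# `BalabanImbrieJaffe1984to88.BIJ85FibreDuality` — T. Bałaban, J. Imbrie, A. Jaffe, *Renormalization of the Higgs model:
minimizers, propagators and the stability of mean field theory*, Commun. Math. Phys. **97** (1985) 299–329
[BalabanImbrieJaffe1985]: Sect. 4.2 (4.2.1) p. 310 / Sect. 7.1 (7.1.12)–(7.1.16) pp. 322–323 — **the variational (Lagrange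
multiplier) lower bound for the fibre problem defining σ_k(p′), for EVERY block size n = L^k** (even L included): the
fibrewise constrained minimisation of `‖∂A − Q^{e*}_kf‖²` over `Q_kA = 0` (p27's `BIJ85Eq7112FibreEnergy.fibreEnergy` /
`FibreConstraint`, offsets `l = 2πk`, `k : Fin d → Fin n` — the complete residue system the printed *"l ∈ 2πZ^d, |l_i| ≤ π/η"*
denotes) is bounded below by its Lagrangian dual at any dual-feasible test family — file 1 of seat p10 gen 5
(`BIJ85FibreDuality`/`BIJ85FibreDualBound` → `BIJ85FibreCurlIntertwine` → `BIJ85FibreOffCentre` → `BIJ85Thm711AllL`: Theorem 7.1.1 in configuration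
space for all n, closing the odd-n scope note `HOME/GAPS.md` G-C1-p27-02 of p10/p27's `BIJ85Thm711ConfigSpace`)

statement-level skeleton of published theorems with citation tags; proofs where landed; nothing here is a claim about
the Yang–Mills mass gap

PDF held: `paper:balaban1985-cmp97-bij-higgs-minimizers` (journal page = PDF page + 298).  Renders read as images: PDF pp.
12, 23–27 (journal 310, 321–325), `run/shared/lean/pub/pub-balaban/t4/b2b-balaban-t4-lit2/renders/bij1985/…-p012/p023…p027-x2.png`.

CITATION HEADER (lean-in-tree rule).  Part of the lit-balaban TYPED SKELETON (HOME `run/shared/lean/pub/lit-balaban/`); WHAT IS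
REPRODUCED: the structure of SKELETON rows **C1.Eq7.1.13-7.1.19** / **C1.Thm7.1.1** (`HOME/lit-balaban-r15/ROWS-C1.md`, fold
owner r15, referee ref-5).  THE PRINTED TEXT (p. 322 [PDF 24]): *"The basic object we wish to study is σ_k, defined in (4.2.2),
σ_k = Q^e_k(I − ∂G_{k,Ax}∂^*)Q^{e*}_k. (7.1.12) … Starting from this expression, one can derive the following formulas for σ_k(p)
by straightforward, algebraic manipulation: We express σ_k as a sum of two terms σ_k = τ₁ + τ₂. (7.1.13) Here τ₁ vanishes on
curls. … The second term τ₂ is a function of Δ_k …"*; (4.2.1) p. 310: *"exp(−½⟨f,σ_kf⟩) = Z^{−1}∫𝒟A δ(Q_kA)δ_{k,Ax}(A)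
exp(−½‖∂A − Q^{e*}_kf‖²)"* — whose Gaussian infimum is the constrained minimum of `½‖∂A − Q^{e*}_kf‖²` over `Q_kA = 0`.
TYPED READING (pub-balaban's offset language, as in `BIJ85Eq7112FibreEnergy`): at the unit momentum `p′ = sOf M q` of the torus
`Tor M`, offsets `l = 2πk`, `k : Fin d → Fin n` (ALL residues, every `n ≥ 1`); `∂_μ(p′+l) = B5Prop11Fiber.dSym n k p′ μ`,
`∂^{(1)}_μ(p′) = d1Sym p′ μ`, `v_μ, u = B5Prop11Fiber.vSym/uSym` ([6I] (1.61), value 1 at the removable singularity), the (7.1.11)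
weight `w = BIJ85Eq7111EdgeAverage.edgeW` (p27).  WHAT IS KERNEL-CHECKED (zero `sorry`, standard axioms), for EVERY n ≥ 1:
 §1 the fibre data `lapK` (Δ(p′+l) (7.1.6)), `rK` (u v_ν, the symbol of Q_k), `srcK` (the source `w̄φ` of (7.1.12)), `divK`,
    `AK` (the averaging one-form through which the multiplier sees the source, cf. a_μ (7.1.16)), `phiK` (**(7.1.10) verbatim**,
    the l-sum over the complete residue system), `curlK`; `fibreEnergy_eq`;
 §2 **WEAK DUALITY** `weak_duality`: for every dual-feasible antisymmetric test family `T` (feasibility: `2Σ_μ ∂_μ(p′+l)T̄_l(μ,ν) =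
    Λ_ν·u v_ν(p′+l)` for a multiplier `Λ`) and every `α` obeying the fibre constraint, `Σ_l Σ_{μν}(2Re T̄_lB_l − |T_l|²) ≤ E_{p′}(α,φ)`;
 §3 the τ₂-type certificate `zK` (`= ∂(p′+l) ∧ x_l`, `x_l(ν) = conj(Λ_ν u v_ν)/(2Δ)(p′+l)`): feasible when `Σ_ν ∂^{(1)}_ν(p′)Λ_ν = 0`
    (`zK_feasible` — the mechanism *"τ₁ vanishes on curls"* / (7.1.18) in dual form), its pairing `pair_zK` and norm bound
    `norm_zK_sum_le` (≤ `Σ_ν|Λ_ν|²|u v_ν|²/Δ`, summing to φ_ν(p′) of (7.1.10));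
 §4 symmetry of the (7.1.11) weight in the orientation pair (`edgeW_symm`) and antisymmetry of the source (`srcK_antisymm`).
The combined bound with the τ₀ part (a co-closed g at l = 0) and the τ₂ part (a multiplier Λ ⊥ ∂^{(1)}(p′)) is the sibling
`BIJ85FibreDualBound.dual_bound`.  NOT CLAIMED here: the choice of (g, Λ) and the bounds turning the dual value into c‖φ‖²
(files 2–4); the exact value of the minimum (= ⟨f,(τ₁+τ₂)f⟩, gen-4 `BIJ85Eq7113Derivation*` for odd n).  Unit `lit-balaban-p10`
(gen 5), HOME as above.
-/

namespace Literature.MathematicalPhysics.QuantumFieldTheory.BalabanImbrieJaffe1984to88.BIJ85FibreDuality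

open scoped BigOperators ComplexConjugate
open Complex Finset
open Literature.MathematicalPhysics.QuantumFieldTheory.Balaban1983to89
open Literature.MathematicalPhysics.QuantumFieldTheory.Balaban1983to89.B5Prop11Plancherel
open Literature.MathematicalPhysics.QuantumFieldTheory.Balaban1983to89.B5Prop11Fiber
open Literature.MathematicalPhysics.QuantumFieldTheory.BalabanImbrieJaffe1984to88.BIJ85Eq7111EdgeAverage
open Literature.MathematicalPhysics.QuantumFieldTheory.BalabanImbrieJaffe1984to88.BIJ85Eq7112FibreEnergy

noncomputable section

variable {d : ℕ} (n : ℕ) [NeZero n] (M : Fin d → ℕ)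

/-! ## §1 The fibre data at the unit momentum p′ = sOf q, offsets l = 2πk, k : Fin d → Fin n -/

/-- Δ(p′+l) = Σ_μ |∂_μ(p′+l)|² at the offset l = 2πk above p′ ((7.1.6) on the η-lattice, η = 1/n).
[cite: BalabanImbrieJaffe1985, (7.1.6) p.322] -/
def lapK (q : Tor M) (k : Fin d → Fin n) : ℝ := ∑ μ, ‖dSym n k (sOf M q) μ‖ ^ 2

/-- r_ν(p′+l) = u(p′+l)v_ν(p′+l): the momentum symbol of the block average Q_k in direction ν ([6I] (1.61)), the constraint
weights of (4.2.1). [cite: BalabanImbrieJaffe1985, (7.1.10) p.322] -/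
def rK (q : Tor M) (k : Fin d → Fin n) (ν : Fin d) : ℂ := uSym n k (sOf M q) * vSym n k (sOf M q) ν

/-- The source two-form at the offset l: B_l(μ,ν) = w̄_{μν}(p′+l)φ_{μν} — the momentum components of Q^{e*}_kf above p′
((7.1.11)/(7.1.12); w = p27's `edgeW`). [cite: BalabanImbrieJaffe1985, (7.1.12) p.322] -/
def srcK (q : Tor M) (φ : Fin d × Fin d → ℂ) (k : Fin d → Fin n) (μ ν : Fin d) : ℂ :=
  conj (edgeW n k (sOf M q) μ ν) * φ (μ, ν)

/-- The η-curl of the fibre variables at the offset l: X_l(μ,ν) = ∂_μ(p′+l)α_l(ν) − ∂_ν(p′+l)α_l(μ).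
[cite: BalabanImbrieJaffe1985, (7.1.12) p.322] -/
def curlK (q : Tor M) (α : (Fin d → Fin n) → Fin d → ℂ) (k : Fin d → Fin n) (μ ν : Fin d) : ℂ :=
  dSym n k (sOf M q) μ * α k ν - dSym n k (sOf M q) ν * α k μ

/-- The divergence of the source at the offset l: D_l(ν) = Σ_μ ∂̄_μ(p′+l)B_l(μ,ν). [cite: BalabanImbrieJaffe1985, (7.1.13) p.322] -/
def divK (q : Tor M) (φ : Fin d × Fin d → ℂ) (k : Fin d → Fin n) (ν : Fin d) : ℂ :=
  ∑ μ, conj (dSym n k (sOf M q) μ) * srcK n M q φ k μ ν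

/-- A_ν(φ) = Σ_l r_ν(p′+l)D_l(ν)/Δ(p′+l): the averaged one-form through which the Lagrange multiplier of the constraint sees the
source (the averaging behind a_μ(p′) of (7.1.16)). [cite: BalabanImbrieJaffe1985, (7.1.16) p.323] -/
def AK (q : Tor M) (φ : Fin d × Fin d → ℂ) (ν : Fin d) : ℂ :=
  ∑ k, rK n M q k ν * divK n M q φ k ν / (lapK n M q k : ℂ)

/-- **(7.1.10)** p. 322 [PDF 24], verbatim: *"φ_μ(p′) = Σ_{l∈2πZ^d, |l_i|≤π/η} |u(p′+l)v_μ(p′+l)|²Δ(p′+l)^{−1}. (7.1.10)"* — the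
l-sum running over the COMPLETE residue system of offsets k : Fin d → Fin n (every n; for odd n = 2M+1 it is r15's `phiSym` over
`lShifts`, cf. `BIJ85Eq7113DerivationPart6`). [cite: BalabanImbrieJaffe1985, (7.1.10) p.322] -/
def phiK (q : Tor M) (ν : Fin d) : ℝ := ∑ k, ‖rK n M q k ν‖ ^ 2 / lapK n M q k

/-- The fibre energy of p27 in the present notation: E_{p′}(α,φ) = Σ_l Σ_{μν} |X_l(μ,ν) − B_l(μ,ν)|².
[cite: BalabanImbrieJaffe1985, (7.1.12) p.322] -/
theorem fibreEnergy_eq (q : Tor M) (φ : Fin d × Fin d → ℂ) (α : (Fin d → Fin n) → Fin d → ℂ) :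
    fibreEnergy n M q α φ = ∑ k, ∑ μ, ∑ ν, ‖curlK n M q α k μ ν - srcK n M q φ k μ ν‖ ^ 2 := by
  rw [fibreEnergy]
  refine Finset.sum_congr rfl fun k _ => ?_
  rw [Fintype.sum_prod_type]
  rfl

omit [NeZero n] in
/-- kernel: Σ_μ ∂_μ∂̄_μ = Δ(p′+l) as a complex number. [cite: BalabanImbrieJaffe1985, (7.1.6) p.322] -/
theorem sum_dSym_mul_conj (q : Tor M) (k : Fin d → Fin n) :
    ∑ μ, dSym n k (sOf M q) μ * conj (dSym n k (sOf M q) μ) = (lapK n M q k : ℂ) := by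
  rw [lapK]
  push_cast
  exact Finset.sum_congr rfl fun μ _ => Complex.mul_conj' _

omit [NeZero n] in
/-- kernel: Δ(p′+l) ≥ 0. [cite: BalabanImbrieJaffe1985, (7.1.6) p.322] -/
theorem lapK_nonneg (q : Tor M) (k : Fin d → Fin n) : 0 ≤ lapK n M q k :=
  Finset.sum_nonneg fun _ _ => sq_nonneg _

/-- kernel: the constraint weights pair the η-derivative with the unit one: ∂_μ(p′+l)·r_μ(p′+l) = u(p′+l)·∂^{(1)}_μ(p′) ([6I] (1.61):
∂^{(1)}_μ = v_μ∂_μ at every offset, removable singularity included). [cite: BalabanImbrieJaffe1985, (7.1.7) p.322] -/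
theorem dSym_mul_rK (q : Tor M) (k : Fin d → Fin n) (μ : Fin d) :
    dSym n k (sOf M q) μ * rK n M q k μ = uSym n k (sOf M q) * d1Sym (sOf M q) μ := by
  rw [rK, d1Sym_eq_vSym_mul n NeZero.one_le k (sOf M q) μ]
  ring

/-! ## §2 Weak duality for the constrained fibre problem -/

/-- kernel: |X − B|² ≥ 2Re(T̄B) − |T|² − 2Re(T̄X) for complex numbers (from |X − B + T|² ≥ 0). [folklore] -/
private theorem pointwise_dual (X B T : ℂ) :
    2 * (conj T * B).re - ‖T‖ ^ 2 - 2 * (conj T * X).re ≤ ‖X - B‖ ^ 2 := by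
  have h0 : 0 ≤ Complex.normSq (X - B + T) := Complex.normSq_nonneg _
  rw [Complex.normSq_add, Complex.normSq_eq_norm_sq, Complex.normSq_eq_norm_sq] at h0
  have h1 : ((X - B) * conj T).re = (conj T * X).re - (conj T * B).re := by
    rw [mul_comm, mul_sub, Complex.sub_re]
  linarith

/-- kernel: for an antisymmetric T, Σ_{μν} T̄_{μν}(e_μα_ν − e_να_μ) = Σ_ν α_ν·(2Σ_μ e_μT̄_{μν}). [folklore] -/
private theorem pairing_curl (e α : Fin d → ℂ) (T : Fin d → Fin d → ℂ) (hT : ∀ μ ν, T ν μ = -T μ ν) :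
    ∑ μ, ∑ ν, conj (T μ ν) * (e μ * α ν - e ν * α μ) = ∑ ν, α ν * (2 * ∑ μ, e μ * conj (T μ ν)) := by
  have h1 : ∑ μ, ∑ ν, conj (T μ ν) * (e ν * α μ) = -∑ μ, ∑ ν, conj (T μ ν) * (e μ * α ν) := by
    rw [Finset.sum_comm, ← Finset.sum_neg_distrib]
    refine Finset.sum_congr rfl fun a _ => ?_
    rw [← Finset.sum_neg_distrib]
    refine Finset.sum_congr rfl fun b _ => ?_
    rw [hT a b, map_neg]
    ring
  calc ∑ μ, ∑ ν, conj (T μ ν) * (e μ * α ν - e ν * α μ)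
      = ∑ μ, ∑ ν, conj (T μ ν) * (e μ * α ν) - ∑ μ, ∑ ν, conj (T μ ν) * (e ν * α μ) := by
        rw [← Finset.sum_sub_distrib]
        refine Finset.sum_congr rfl fun μ _ => ?_
        rw [← Finset.sum_sub_distrib]
        exact Finset.sum_congr rfl fun ν _ => by ring
    _ = 2 * ∑ μ, ∑ ν, conj (T μ ν) * (e μ * α ν) := by rw [h1]; ring
    _ = ∑ ν, α ν * (2 * ∑ μ, e μ * conj (T μ ν)) := by
        rw [Finset.sum_comm, Finset.mul_sum]
        refine Finset.sum_congr rfl fun ν _ => ?_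
        simp only [Finset.mul_sum]
        exact Finset.sum_congr rfl fun μ _ => by ring

/-- **WEAK DUALITY for the fibre problem (4.2.1)/(7.1.12)**, every n: if a test family T (antisymmetric two-forms T_l, one per offset)
is DUAL-FEASIBLE — `2Σ_μ ∂_μ(p′+l)T̄_l(μ,ν) = Λ_ν u v_ν(p′+l)` for all l, ν, with a multiplier Λ of the constraint Σ_l u v_ν(p′+l)α_l(ν)
= 0 — then for every α obeying the fibre constraint, `Σ_l Σ_{μν} (2Re T̄_l(μ,ν)B_l(μ,ν) − |T_l(μ,ν)|²) ≤ E_{p′}(α, φ)`: the pairing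
of T with the η-curls is Λ·(Q_kα) = 0, and |X − B|² ≥ 2Re T̄(B − X) − |T|² termwise.  This is the variational content of
(7.1.12)–(7.1.13) in the direction needed for Theorem 7.1.1 (a lower bound for the Gaussian infimum of (4.2.1)).
[cite: BalabanImbrieJaffe1985, (7.1.12) p.322] -/
theorem weak_duality (q : Tor M) (φ : Fin d × Fin d → ℂ) (α : (Fin d → Fin n) → Fin d → ℂ)
    (hα : FibreConstraint n M q α) (T : (Fin d → Fin n) → Fin d → Fin d → ℂ) (hT : ∀ k μ ν, T k ν μ = -T k μ ν)
    (Λ : Fin d → ℂ) (hfeas : ∀ k ν, 2 * ∑ μ, dSym n k (sOf M q) μ * conj (T k μ ν) = Λ ν * rK n M q k ν) :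
    ∑ k, ∑ μ, ∑ ν, (2 * (conj (T k μ ν) * srcK n M q φ k μ ν).re - ‖T k μ ν‖ ^ 2) ≤ fibreEnergy n M q α φ := by
  -- the pairing of T with the η-curls vanishes: feasibility turns it into Λ·(constraint) = 0
  have hX : ∑ k, ∑ μ, ∑ ν, conj (T k μ ν) * curlK n M q α k μ ν = 0 := by
    calc ∑ k, ∑ μ, ∑ ν, conj (T k μ ν) * curlK n M q α k μ ν
        = ∑ k, ∑ ν, α k ν * (Λ ν * rK n M q k ν) := by
          refine Finset.sum_congr rfl fun k _ => ?_
          have h := pairing_curl (dSym n k (sOf M q)) (α k) (T k) (hT k)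
          simp only [curlK]
          rw [h]
          exact Finset.sum_congr rfl fun ν _ => by rw [hfeas k ν]
      _ = ∑ ν, Λ ν * ∑ k, uSym n k (sOf M q) * vSym n k (sOf M q) ν * α k ν := by
          rw [Finset.sum_comm]
          refine Finset.sum_congr rfl fun ν _ => ?_
          rw [Finset.mul_sum]
          exact Finset.sum_congr rfl fun k _ => by rw [rK]; ring
      _ = 0 := Finset.sum_eq_zero fun ν _ => by rw [hα ν, mul_zero]
  -- the termwise inequality, summed
  have hsum : ∑ k, ∑ μ, ∑ ν, (2 * (conj (T k μ ν) * srcK n M q φ k μ ν).re - ‖T k μ ν‖ ^ 2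
      - 2 * (conj (T k μ ν) * curlK n M q α k μ ν).re) ≤ fibreEnergy n M q α φ := by
    rw [fibreEnergy_eq]
    exact Finset.sum_le_sum fun k _ => Finset.sum_le_sum fun μ _ => Finset.sum_le_sum fun ν _ =>
      pointwise_dual (curlK n M q α k μ ν) (srcK n M q φ k μ ν) (T k μ ν)
  have hsplit : ∑ k, ∑ μ, ∑ ν, (2 * (conj (T k μ ν) * srcK n M q φ k μ ν).re - ‖T k μ ν‖ ^ 2)
      = (∑ k, ∑ μ, ∑ ν, (2 * (conj (T k μ ν) * srcK n M q φ k μ ν).re - ‖T k μ ν‖ ^ 2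
          - 2 * (conj (T k μ ν) * curlK n M q α k μ ν).re))
        + 2 * (∑ k, ∑ μ, ∑ ν, conj (T k μ ν) * curlK n M q α k μ ν).re := by
    simp only [Complex.re_sum, Finset.mul_sum, ← Finset.sum_add_distrib]
    exact Finset.sum_congr rfl fun k _ => Finset.sum_congr rfl fun μ _ => Finset.sum_congr rfl fun ν _ => by ring
  rw [hsplit, hX, Complex.zero_re, mul_zero, add_zero]
  exact hsum

/-! ## §3 The τ₂-type certificate: Z_l = ∂(p′+l) ∧ x_l -/

/-- The multiplier one-forms x_l(ν) = conj(Λ_ν r_ν(p′+l))/(2Δ(p′+l)). [cite: BalabanImbrieJaffe1985, (7.1.15) p.323] -/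
def xK (q : Tor M) (Λ : Fin d → ℂ) (k : Fin d → Fin n) (ν : Fin d) : ℂ :=
  conj (Λ ν * rK n M q k ν) / (2 * (lapK n M q k : ℂ))

/-- The τ₂ test family Z_l(μ,ν) = ∂_μ(p′+l)x_l(ν) − ∂_ν(p′+l)x_l(μ) — an η-curl at every offset (so that, in the exact problem, it
pairs with the source through the "curl part"; its feasibility below is the dual form of (7.1.18) "τ₁ vanishes on curls").
[cite: BalabanImbrieJaffe1985, (7.1.15) p.323] -/
def zK (q : Tor M) (Λ : Fin d → ℂ) (k : Fin d → Fin n) (μ ν : Fin d) : ℂ :=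
  dSym n k (sOf M q) μ * xK n M q Λ k ν - dSym n k (sOf M q) ν * xK n M q Λ k μ

omit [NeZero n] in
/-- Z_l is antisymmetric. [cite: BalabanImbrieJaffe1985, (7.1.15) p.323] -/
theorem zK_antisymm (q : Tor M) (Λ : Fin d → ℂ) (k : Fin d → Fin n) (μ ν : Fin d) :
    zK n M q Λ k ν μ = -zK n M q Λ k μ ν := by
  simp only [zK]
  ring

omit [NeZero n] in
/-- kernel: x̄_l(ν) = Λ_ν r_ν(p′+l)/(2Δ(p′+l)). [cite: BalabanImbrieJaffe1985, (7.1.15) p.323] -/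
theorem conj_xK (q : Tor M) (Λ : Fin d → ℂ) (k : Fin d → Fin n) (ν : Fin d) :
    conj (xK n M q Λ k ν) = Λ ν * rK n M q k ν / (2 * (lapK n M q k : ℂ)) := by
  simp only [xK, map_div₀, map_mul, Complex.conj_conj, Complex.conj_ofReal, map_ofNat]

/-- **Dual feasibility of the τ₂ family**: if the multiplier is orthogonal to the unit derivative, Σ_ν ∂^{(1)}_ν(p′)Λ_ν = 0, and no
Δ(p′+l) vanishes, then `2Σ_μ ∂_μ(p′+l)Z̄_l(μ,ν) = Λ_ν u v_ν(p′+l)` at every offset: the cross term is ∂̄_ν·u·Σ_μ ∂^{(1)}_μΛ_μ/(2Δ) = 0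
because ∂_μ·u v_μ = u∂^{(1)}_μ at EVERY l ((7.1.7); the dual form of Q^{e*}_k∂^{(1)} = ∂Q^{s*}_k, (7.1.18)).
[cite: BalabanImbrieJaffe1985, (7.1.18) p.323] -/
theorem zK_feasible (q : Tor M) (Λ : Fin d → ℂ) (hΛ : ∑ ν, d1Sym (sOf M q) ν * Λ ν = 0)
    (hΔ : ∀ k, lapK n M q k ≠ 0) (k : Fin d → Fin n) (ν : Fin d) :
    2 * ∑ μ, dSym n k (sOf M q) μ * conj (zK n M q Λ k μ ν) = Λ ν * rK n M q k ν := by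
  have hΔc : (lapK n M q k : ℂ) ≠ 0 := Complex.ofReal_ne_zero.mpr (hΔ k)
  have hsum0 : ∑ μ, dSym n k (sOf M q) μ * conj (xK n M q Λ k μ) = 0 := by
    have hterm : ∀ μ, dSym n k (sOf M q) μ * conj (xK n M q Λ k μ)
        = uSym n k (sOf M q) / (2 * (lapK n M q k : ℂ)) * (d1Sym (sOf M q) μ * Λ μ) := by
      intro μ
      rw [conj_xK, show dSym n k (sOf M q) μ * (Λ μ * rK n M q k μ / (2 * (lapK n M q k : ℂ)))
        = Λ μ * (dSym n k (sOf M q) μ * rK n M q k μ) / (2 * (lapK n M q k : ℂ)) by ring, dSym_mul_rK]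
      ring
    simp_rw [hterm]
    rw [← Finset.mul_sum, hΛ, mul_zero]
  calc 2 * ∑ μ, dSym n k (sOf M q) μ * conj (zK n M q Λ k μ ν)
      = 2 * ∑ μ, (dSym n k (sOf M q) μ * conj (dSym n k (sOf M q) μ) * conj (xK n M q Λ k ν)
          - conj (dSym n k (sOf M q) ν) * (dSym n k (sOf M q) μ * conj (xK n M q Λ k μ))) := by
        congr 1
        refine Finset.sum_congr rfl fun μ _ => ?_
        simp only [zK, map_sub, map_mul]
        ring
    _ = 2 * ((lapK n M q k : ℂ) * conj (xK n M q Λ k ν))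
        - 2 * conj (dSym n k (sOf M q) ν) * ∑ μ, dSym n k (sOf M q) μ * conj (xK n M q Λ k μ) := by
        rw [Finset.sum_sub_distrib, ← Finset.sum_mul, ← Finset.mul_sum, sum_dSym_mul_conj]
        ring
    _ = Λ ν * rK n M q k ν := by
        rw [hsum0, mul_zero, sub_zero, conj_xK]
        field_simp

omit [NeZero n] in
/-- **The pairing of the τ₂ family with an antisymmetric two-form G is twice the pairing of x_l with the divergence of G**:
Σ_{μν} Z̄_l(μ,ν)G(μ,ν) = 2Σ_ν x̄_l(ν)·Σ_μ ∂̄_μ(p′+l)G(μ,ν). [cite: BalabanImbrieJaffe1985, (7.1.15) p.323] -/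
theorem pair_zK (q : Tor M) (Λ : Fin d → ℂ) (k : Fin d → Fin n) (G : Fin d → Fin d → ℂ) (hG : ∀ μ ν, G ν μ = -G μ ν) :
    ∑ μ, ∑ ν, conj (zK n M q Λ k μ ν) * G μ ν
      = 2 * ∑ ν, conj (xK n M q Λ k ν) * ∑ μ, conj (dSym n k (sOf M q) μ) * G μ ν := by
  have h1 : ∑ μ, ∑ ν, conj (dSym n k (sOf M q) μ) * conj (xK n M q Λ k ν) * G μ ν
      = ∑ ν, conj (xK n M q Λ k ν) * ∑ μ, conj (dSym n k (sOf M q) μ) * G μ ν := by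
    rw [Finset.sum_comm]
    refine Finset.sum_congr rfl fun ν _ => ?_
    rw [Finset.mul_sum]
    exact Finset.sum_congr rfl fun μ _ => by ring
  have h2 : ∑ μ, ∑ ν, conj (dSym n k (sOf M q) ν) * conj (xK n M q Λ k μ) * G μ ν
      = -∑ μ, conj (xK n M q Λ k μ) * ∑ ν, conj (dSym n k (sOf M q) ν) * G ν μ := by
    rw [← Finset.sum_neg_distrib]
    refine Finset.sum_congr rfl fun μ _ => ?_
    rw [Finset.mul_sum, ← Finset.sum_neg_distrib]
    exact Finset.sum_congr rfl fun ν _ => by rw [hG μ ν]; ring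
  calc ∑ μ, ∑ ν, conj (zK n M q Λ k μ ν) * G μ ν
      = ∑ μ, ∑ ν, conj (dSym n k (sOf M q) μ) * conj (xK n M q Λ k ν) * G μ ν
          - ∑ μ, ∑ ν, conj (dSym n k (sOf M q) ν) * conj (xK n M q Λ k μ) * G μ ν := by
        rw [← Finset.sum_sub_distrib]
        refine Finset.sum_congr rfl fun μ _ => ?_
        rw [← Finset.sum_sub_distrib]
        refine Finset.sum_congr rfl fun ν _ => ?_
        simp only [zK, map_sub, map_mul]
        ring
    _ = 2 * ∑ ν, conj (xK n M q Λ k ν) * ∑ μ, conj (dSym n k (sOf M q) μ) * G μ ν := by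
        rw [h1, h2]
        ring

/-- kernel: Σ_{μν}(2a_μb_ν + 2a_νb_μ) = 4(Σa)(Σb) for real families. [folklore] -/
private theorem sum_sum_cross (a b : Fin d → ℝ) :
    ∑ μ, ∑ ν, (2 * (a μ * b ν) + 2 * (a ν * b μ)) = 4 * (∑ μ, a μ) * ∑ ν, b ν := by
  have h1 : ∑ μ, ∑ ν, a μ * b ν = (∑ μ, a μ) * ∑ ν, b ν := by rw [Finset.sum_mul_sum]
  have h2 : ∑ μ, ∑ ν, a ν * b μ = (∑ μ, a μ) * ∑ ν, b ν := by rw [Finset.sum_comm, Finset.sum_mul_sum]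
  have h3 : ∑ μ, ∑ ν, (2 * (a μ * b ν) + 2 * (a ν * b μ)) = 2 * ∑ μ, ∑ ν, a μ * b ν + 2 * ∑ μ, ∑ ν, a ν * b μ := by
    rw [Finset.mul_sum, Finset.mul_sum, ← Finset.sum_add_distrib]
    refine Finset.sum_congr rfl fun μ _ => ?_
    rw [Finset.mul_sum, Finset.mul_sum, ← Finset.sum_add_distrib]
  rw [h3, h1, h2]
  ring

omit [NeZero n] in
/-- **Norm of the τ₂ family**: Σ_{μν}|Z_l(μ,ν)|² ≤ Σ_ν |Λ_ν|²|u v_ν(p′+l)|²/Δ(p′+l) (Δ(p′+l) ≠ 0) — summed over l this is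
Σ_ν φ_ν(p′)|Λ_ν|² with the φ_ν of (7.1.10). [cite: BalabanImbrieJaffe1985, (7.1.10) p.322] -/
theorem norm_zK_sum_le (q : Tor M) (Λ : Fin d → ℂ) (k : Fin d → Fin n) (hΔ : lapK n M q k ≠ 0) :
    ∑ μ, ∑ ν, ‖zK n M q Λ k μ ν‖ ^ 2 ≤ ∑ ν, ‖Λ ν‖ ^ 2 * ‖rK n M q k ν‖ ^ 2 / lapK n M q k := by
  have hΔpos : 0 < lapK n M q k := lt_of_le_of_ne (lapK_nonneg n M q k) (Ne.symm hΔ)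
  have hx : ∀ ν, ‖xK n M q Λ k ν‖ ^ 2 = ‖Λ ν‖ ^ 2 * ‖rK n M q k ν‖ ^ 2 / (4 * lapK n M q k ^ 2) := by
    intro ν
    rw [xK, norm_div, Complex.norm_conj, norm_mul, norm_mul, Complex.norm_real, Real.norm_of_nonneg hΔpos.le,
      Complex.norm_two]
    field_simp
    ring
  have hpt : ∀ μ ν, ‖zK n M q Λ k μ ν‖ ^ 2
      ≤ 2 * (‖dSym n k (sOf M q) μ‖ ^ 2 * ‖xK n M q Λ k ν‖ ^ 2)
        + 2 * (‖dSym n k (sOf M q) ν‖ ^ 2 * ‖xK n M q Λ k μ‖ ^ 2) := by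
    intro μ ν
    have h := norm_sub_le (dSym n k (sOf M q) μ * xK n M q Λ k ν) (dSym n k (sOf M q) ν * xK n M q Λ k μ)
    rw [norm_mul, norm_mul] at h
    rw [zK]
    nlinarith [h, norm_nonneg (dSym n k (sOf M q) μ * xK n M q Λ k ν - dSym n k (sOf M q) ν * xK n M q Λ k μ),
      sq_nonneg (‖dSym n k (sOf M q) μ‖ * ‖xK n M q Λ k ν‖ - ‖dSym n k (sOf M q) ν‖ * ‖xK n M q Λ k μ‖),
      mul_nonneg (norm_nonneg (dSym n k (sOf M q) μ)) (norm_nonneg (xK n M q Λ k ν)),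
      mul_nonneg (norm_nonneg (dSym n k (sOf M q) ν)) (norm_nonneg (xK n M q Λ k μ))]
  calc ∑ μ, ∑ ν, ‖zK n M q Λ k μ ν‖ ^ 2
      ≤ ∑ μ, ∑ ν, (2 * (‖dSym n k (sOf M q) μ‖ ^ 2 * ‖xK n M q Λ k ν‖ ^ 2)
          + 2 * (‖dSym n k (sOf M q) ν‖ ^ 2 * ‖xK n M q Λ k μ‖ ^ 2)) :=
        Finset.sum_le_sum fun μ _ => Finset.sum_le_sum fun ν _ => hpt μ ν
    _ = 4 * lapK n M q k * ∑ ν, ‖xK n M q Λ k ν‖ ^ 2 := by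
        rw [sum_sum_cross, lapK]
    _ = ∑ ν, ‖Λ ν‖ ^ 2 * ‖rK n M q k ν‖ ^ 2 / lapK n M q k := by
        rw [Finset.mul_sum]
        refine Finset.sum_congr rfl fun ν _ => ?_
        rw [hx ν]
        field_simp

/-! ## §4 Symmetry of the weight and antisymmetry of the source -/

/-- kernel: `edgeW` is symmetric in the orientation pair (the edge set B^e_k(μν) = B^e_k(νμ)). [cite: BalabanImbrieJaffe1985, (2.21) p.305] -/
theorem edgeW_symm (k : Fin d → Fin n) (s : Fin d → ℝ) (μ ν : Fin d) : edgeW n k s ν μ = edgeW n k s μ ν := by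
  unfold edgeW
  congr 1
  refine Finset.prod_congr rfl fun ρ _ => ?_
  simp only [edgeSlots, or_comm]

/-- The source of an antisymmetric φ is antisymmetric. [cite: BalabanImbrieJaffe1985, (7.1.12) p.322] -/
theorem srcK_antisymm (q : Tor M) {φ : Fin d × Fin d → ℂ} (hφ : ∀ μ ν, φ (ν, μ) = -φ (μ, ν)) (k : Fin d → Fin n)
    (μ ν : Fin d) : srcK n M q φ k ν μ = -srcK n M q φ k μ ν := by
  rw [srcK, srcK, edgeW_symm, hφ μ ν, mul_neg]

end

end Literature.MathematicalPhysics.QuantumFieldTheory.BalabanImbrieJaffe1984to88.BIJ85FibreDuality
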